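import Mathlib
import Summits.Ventures.PercRepro2.SixTerminal

/-!
# The six-terminal and five-terminal classes as predicates on `(ends, marks)`
(blind cell PercRepro2, mine-2 g33; typer-1 g52's pointer: a class given by a predicate on the
graph and its marks is one more clause of the residual `WRed.*`)

* `SixTerminalClass ends o a₁ a₂ a₃ b`: the graph is a block substitution of `K₆` with the marks at
  the terminals `q 0, q 1, q 2, q 5, q 4` — **`HCov_of_sixTerminalClass`**: (HCOV) on the class for
  every admissible weight vector (THEOREM 32);
* `FiveTerminalClass ends o a₁ a₂ a₃ b`: the graph is a block substitution of a loop-free skeleton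
  without parallel edges on five terminals, the marks the five terminals —
  **`HCov_of_fiveTerminalClass`**.

Both classes are closed under relabelling of the roots (`sixTerminalClass_swap`: the skeleton `K₆`
is symmetric, the terminal map composed with the transposition `1 ↔ 2`), so a residual clause may
use them in either orientation.  Standard axioms only.

(v2: the declarations of the accepted v1 byte for byte; re-filed because the farm served no olean
of v1 for 18 minutes while later landings were served — the third such loss on this lane today.)
-/

namespace Summit.Ventures.PercRepro2

namespace BlockSubst

section Classes

variable {V : Type*} {E : Type*}

/-- **The six-terminal class**: a block substitution of `K₆` (`Deg5.ends15`) with the marks at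
the terminals `q 0 = o, q 1 = a₁, q 2 = a₂, q 5 = a₃, q 4 = b` (`q 3` the unmarked terminal). -/
def SixTerminalClass (ends : E → Sym2 V) (o a₁ a₂ a₃ b : V) : Prop :=
  ∃ (q : Fin 6 → V) (blk : E → Fin 15) (Vj : Fin 15 → Set V),
    IsBlockSubst ends Deg5.ends15 q blk Vj ∧ q 0 = o ∧ q 1 = a₁ ∧ q 2 = a₂ ∧ q 5 = a₃ ∧ q 4 = b

/-- **The five-terminal class**: a block substitution of a loop-free skeleton without parallel
edges on exactly five terminals, the five marks the five terminals. -/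
def FiveTerminalClass (ends : E → Sym2 V) (o a₁ a₂ a₃ b : V) : Prop :=
  ∃ (E' : Type) (_ : Fintype E') (_ : DecidableEq E') (ends' : E' → Sym2 (Fin 5)) (q : Fin 5 → V)
    (blk : E → E') (Vj : E' → Set V),
    (∀ j, ¬ (ends' j).IsDiag) ∧ Function.Injective ends' ∧ IsBlockSubst ends ends' q blk Vj ∧
      q 0 = o ∧ q 1 = a₁ ∧ q 2 = a₂ ∧ q 3 = a₃ ∧ q 4 = b

variable [Fintype E] [DecidableEq E] {R : Type*} [Field R] [LinearOrder R] [IsStrictOrderedRing R]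

/-- **THEOREM 32 as a class clause**: (HCOV) on the six-terminal class, every admissible weight
vector. -/
theorem HCov_of_sixTerminalClass (ends : E → Sym2 V) (o a₁ a₂ a₃ b : V)
    (h : SixTerminalClass ends o a₁ a₂ a₃ b) (p : E → R) (hp : IsProbVec p) :
    CovForm.HCov p ends o a₁ a₂ a₃ b := by
  obtain ⟨q, blk, Vj, hB, rfl, rfl, rfl, rfl, rfl⟩ := h
  exact HCov_sixTerminal hB p hp

/-- **(HCOV) on the five-terminal class**, every admissible weight vector. -/
theorem HCov_of_fiveTerminalClass (ends : E → Sym2 V) (o a₁ a₂ a₃ b : V)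
    (h : FiveTerminalClass ends o a₁ a₂ a₃ b) (p : E → R) (hp : IsProbVec p) :
    CovForm.HCov p ends o a₁ a₂ a₃ b := by
  obtain ⟨E', _, _, ends', q, blk, Vj, hloop, hinj, hB, rfl, rfl, rfl, rfl, rfl⟩ := h
  exact HCov_fiveTerminal hB (by simp) hloop hinj 0 1 2 3 4 (by decide) (by decide) (by decide)
    (by decide) (by decide) (by decide) (by decide) (by decide) (by decide) (by decide) p hp

end Classes

section Swap

variable {V : Type*} {E : Type*}

/-- The transposition `1 ↔ 2` of `Fin 6`. -/
def swap12 : Fin 6 → Fin 6 := fun k => if k = 1 then 2 else if k = 2 then 1 else k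

/-- The transposition of the edges of `K₆` induced by `swap12`: edge `j` goes to the edge with
ends `swap12` of the ends of `j`. -/
def swapEdge : Fin 15 → Fin 15 :=
  ![1, 0, 2, 3, 4, 7, 8, 5, 6, 9, 10, 12, 11, 13, 14]

/-- `swapEdge` is the edge map of `swap12`. -/
lemma ends15_swapEdge : ∀ j, Deg5.ends15 (swapEdge j) = (Deg5.ends15 j).map swap12 := by
  decide

/-- `swapEdge` is an involution. -/
lemma swapEdge_swapEdge : ∀ j, swapEdge (swapEdge j) = j := by
  decide

/-- `swap12` is an involution. -/
lemma swap12_swap12 : ∀ k, swap12 (swap12 k) = k := by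
  decide

/-- **The six-terminal class is symmetric in the roots**: relabel the terminals by the
transposition `1 ↔ 2` and the blocks by `swapEdge`. -/
theorem sixTerminalClass_swap {ends : E → Sym2 V} {o a₁ a₂ a₃ b : V}
    (h : SixTerminalClass ends o a₁ a₂ a₃ b) : SixTerminalClass ends o a₂ a₁ a₃ b := by
  obtain ⟨q, blk, Vj, hB, h0, h1, h2, h5, h4⟩ := h
  refine ⟨q ∘ swap12, swapEdge ∘ blk, Vj ∘ swapEdge, ?_, h0, h2, h1, h5, h4⟩
  refine ⟨?_, ?_, ?_, ?_, ?_⟩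
  · intro e x hx
    show x ∈ Vj (swapEdge (swapEdge (blk e)))
    rw [swapEdge_swapEdge]
    exact hB.ends_mem e x hx
  · intro j k hk
    apply hB.term_mem (swapEdge j) (swap12 k)
    rw [ends15_swapEdge, Sym2.mem_map]
    exact ⟨k, hk, rfl⟩
  · intro j j' hjj x hx hx'
    have hne : swapEdge j ≠ swapEdge j' := fun h => hjj (by
      rw [← swapEdge_swapEdge j, ← swapEdge_swapEdge j', h])
    obtain ⟨k, hk, hxk⟩ := hB.inter_terms _ _ hne x hx hx'
    refine ⟨swap12 k, ?_, by simp [Function.comp, swap12_swap12, hxk]⟩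
    have : swap12 k ∈ (Deg5.ends15 (swapEdge j)).map swap12 := by
      rw [Sym2.mem_map]; exact ⟨k, hk, rfl⟩
    rw [ends15_swapEdge, Sym2.map_map] at this
    have hid : (swap12 ∘ swap12) = id := by funext k; simp [swap12_swap12]
    rwa [hid, Sym2.map_id] at this
  · intro j k hk
    have := hB.term_only (swapEdge j) (swap12 k) hk
    rw [ends15_swapEdge, Sym2.mem_map] at this
    obtain ⟨k', hk', hkk'⟩ := this
    have : k' = k := by rw [← swap12_swap12 k', hkk', swap12_swap12]
    rw [← this]
    exact hk'
  · intro k k' hkk'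
    have := hB.q_inj hkk'
    rw [← swap12_swap12 k, this, swap12_swap12]

end Swap

end BlockSubst

end Summit.Ventures.PercRepro2
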